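import Summits.QuantumFields.BalabanUV.Beta.FP.CoarseCovarianceStripFeyn

/-!
# `BalabanUV.Beta.FP.CoarseCovarianceStripFeynReg` — road «FP» (binder row D1), row H′2-IR ∕ IR-2 (ii), file (F) part 2: **entry REGULARITY of the
# holomorphic Feynman matrix `feynC` on the periodic strip** (continuity on `PStrip D κ`, `κ ≤ κ₁₆₆`; slice holomorphy at every `|Im z| < κ₁₆₆`,
# other coordinates anywhere in the closed periodic strip) **and its ENTRY BOUNDS** (`‖p̂_a‖ ≤ 2‖p_a‖` near `0`, `≤ e^{|Im|}+1` everywhere,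
# `‖exC V p α β‖ ≤ 2D²·v·a·b`)

HONEST FRAMING (cell contract, verbatim): «discharging `BetaPertH` makes Bałaban's UV stability UNCONDITIONAL — a real constructive-QFT
result; it is NOT the continuum limit and NOT the Clay problem.»  HONEST DEPENDENCY (verbatim): «continuum YM on T⁴ ⇐ BetaPertH ∧ nine
spine estimates (0/9 proved); BetaPertH ⇐ (D1) ∧ (D4) ∧ CAP+tail; G-an2-4 gates asym, D1 and NE2/3/4.»  THIS MODULE DISCHARGES NOTHING of
D1 ∕ BetaPertH: [folklore] calculus bookkeeping (finite sums∕products of continuous ∕ holomorphic functions, `Complex.norm_exp_sub_one_le`) over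
part 1 and file (W) (`continuousOn_Wper`, `differentiableAt_Wper_update`) BY NAME.  No data def; no `def … : Prop`; nothing is cited; 0 sorry.
NOT summit progress; NOT BetaPertH, NOT continuum, NOT Clay.

ABSOLUTE RULE (cell, verbatim): «No internally-minted statement may enter as a cited fact. Every hypothesis is either kernel-proved in this
package or a verbatim quotation of a PUBLISHED theorem with page reference. The manuscript(s) under audit are NOT citable for their own
disputed steps — they are the thing under adjudication; programme-internal (2001/route/tribunal) claims are never citable.»

CONTENT.
* §4 REGULARITY: `continuous_d1C`, `differentiableAt_d1C_update`, `differentiableAt_curlRow_update`, **`differentiableAt_feynC_update`** (for `p ∈ PStrip D (κ₁₆₆ D)`,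
  `|Im z| < κ₁₆₆ D`: `w ↦ feynC (update p i w) α β` holomorphic at `z`), **`continuousOn_feynC`** (`ContinuousOn (fun p ↦ feynC p α β) (PStrip D κ)`, `0 ≤ κ ≤ κ₁₆₆ D`).
* §5 ENTRY BOUNDS: `norm_d1C_le_two_mul`, `norm_d1C_le_exp`, `norm_d1C_neg_le_exp`, **`norm_exC_le`**.
Unit `b2b-balaban-beta-d1-formalise-leaf-06` (gen 7), owner ruling R-FP-21 (A3)∕(C), INTENT journal l.22234.
-/

noncomputable section

namespace Summit.QuantumFields.BalabanUV.Beta.FP.CoarseCovarianceStripFeynReg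

open Filter Topology Finset Complex Set Metric Matrix
open scoped BigOperators ComplexConjugate
open Literature.MathematicalPhysics.QuantumFieldTheory.Balaban1983to89
open B4Strip (Strip ofRealVec)
open B5Symbol166Strip (kappa166 kappa166_pos)
open Summit.QuantumFields.BalabanUV.Beta.FP.PerfectPropagatorSymbol (curlRow)
open Summit.QuantumFields.BalabanUV.Beta.FP.PerfectPropagatorSplit (norm_curlRow_le)
open Summit.QuantumFields.BalabanUV.Beta.FP.CoarseCovarianceStripW
open Summit.QuantumFields.BalabanUV.Beta.FP.CoarseCovarianceStripWReg (continuousOn_Wper differentiableAt_Wper_update)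
open Summit.QuantumFields.BalabanUV.Beta.FP.CoarseCovarianceStripFeyn

variable {d : ℕ}

/-! ## §4 Regularity of the entries on the periodic strip -/

/-- [folklore] `p̂` is continuous. -/
theorem continuous_d1C : Continuous (d1C : (Fin (d + 1) → ℂ) → Fin (d + 1) → ℂ) :=
  continuous_pi fun a => ((Complex.continuous_exp.comp ((continuous_apply a).mul continuous_const)).sub continuous_const)

/-- [folklore] each entry of `p̂(± update p i w)` is holomorphic in `w`. -/
theorem differentiableAt_d1C_update (p : Fin (d + 1) → ℂ) (i a : Fin (d + 1)) (c : ℂ) (z : ℂ) :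
    DifferentiableAt ℂ (fun w : ℂ => d1C (c • Function.update p i w) a) z := by
  by_cases h : a = i
  · subst h
    have e : (fun w : ℂ => d1C (c • Function.update p a w) a) = fun w => Complex.exp (c * w * I) - 1 := by
      funext w; simp [d1C_apply]
    rw [e]
    exact ((differentiableAt_id.const_mul c).mul_const I).cexp.sub_const 1
  · have e : (fun w : ℂ => d1C (c • Function.update p i w) a) = fun _ => Complex.exp (c * p a * I) - 1 := by
      funext w; simp [d1C_apply, Function.update_of_ne h]
    rw [e]
    exact differentiableAt_const _

/-- [folklore] each curl-row entry of `p̂(c·update p i w)` is holomorphic in `w`. -/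
theorem differentiableAt_curlRow_update (p : Fin (d + 1) → ℂ) (i μ ν α : Fin (d + 1)) (c : ℂ) (z : ℂ) :
    DifferentiableAt ℂ (fun w : ℂ => curlRow (d1C (c • Function.update p i w)) μ ν α) z := by
  simp only [curlRow]
  refine DifferentiableAt.sub ?_ ?_
  · split_ifs
    · exact differentiableAt_d1C_update p i μ c z
    · exact differentiableAt_const _
  · split_ifs
    · exact differentiableAt_d1C_update p i ν c z
    · exact differentiableAt_const _

/-- [our object] **SLICE HOLOMORPHY OF THE FEYNMAN MATRIX ENTRIES**: for `p` in the closed periodic strip of width `κ₁₆₆` and `|Im z| < κ₁₆₆`,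
`w ↦ feynC (update p i w) α β` is holomorphic at `z`. -/
theorem differentiableAt_feynC_update {p : Fin (d + 1) → ℂ} (hp : p ∈ PStrip (d + 1) (kappa166 (d + 1))) (i : Fin (d + 1))
    {z : ℂ} (hz : |z.im| < kappa166 (d + 1)) (α β : Fin (d + 1)) :
    DifferentiableAt ℂ (fun w : ℂ => feynC (Function.update p i w) α β) z := by
  have hneg : ∀ w : ℂ, -(Function.update p i w) = (-1 : ℂ) • Function.update p i w := fun w => by
    funext a; simp
  have hone : ∀ w : ℂ, Function.update p i w = (1 : ℂ) • Function.update p i w := fun w => by simp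
  simp only [feynC, exC]
  refine DifferentiableAt.add (DifferentiableAt.fun_sum fun μ _ => DifferentiableAt.fun_sum fun ν _ => ?_) ?_
  · split_ifs with hμν
    · exact differentiableAt_const _
    · refine DifferentiableAt.mul (DifferentiableAt.div_const (differentiableAt_Wper_update hμν hp i hz) 2) ?_
      refine DifferentiableAt.mul ?_ ?_
      · simp only [hneg]; exact differentiableAt_curlRow_update p i μ ν α (-1) z
      · have := differentiableAt_curlRow_update p i μ ν β 1 z
        simp only [one_smul] at this; exact this
  · refine DifferentiableAt.mul ?_ ?_
    · have := differentiableAt_d1C_update p i α 1 z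
      simp only [one_smul] at this; exact this
    · simp only [hneg]; exact differentiableAt_d1C_update p i β (-1) z

/-- [our object] **CONTINUITY OF THE FEYNMAN MATRIX ENTRIES ON THE PERIODIC STRIP** `PStrip D κ`, `0 ≤ κ ≤ κ₁₆₆`. -/
theorem continuousOn_feynC {κ : ℝ} (hκ0 : 0 ≤ κ) (hκ : κ ≤ kappa166 (d + 1)) (α β : Fin (d + 1)) :
    ContinuousOn (fun p : Fin (d + 1) → ℂ => feynC p α β) (PStrip (d + 1) κ) := by
  have hc1 : Continuous fun p : Fin (d + 1) → ℂ => d1C p := continuous_d1C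
  have hc2 : Continuous fun p : Fin (d + 1) → ℂ => d1C (-p) := continuous_d1C.comp continuous_neg
  have hcurl : ∀ (q : (Fin (d + 1) → ℂ) → Fin (d + 1) → ℂ) (μ ν γ : Fin (d + 1)), Continuous q →
      Continuous fun p => curlRow (q p) μ ν γ := by
    intro q μ ν γ hq
    simp only [curlRow]
    refine Continuous.sub ?_ ?_
    · split_ifs
      · exact (continuous_apply μ).comp hq
      · exact continuous_const
    · split_ifs
      · exact (continuous_apply ν).comp hq
      · exact continuous_const
  simp only [feynC, exC]
  refine ContinuousOn.add (continuousOn_finsetSum _ fun μ _ => continuousOn_finsetSum _ fun ν _ => ?_) ?_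
  · split_ifs with hμν
    · exact continuousOn_const
    · refine ContinuousOn.mul ((continuousOn_Wper hκ0 hκ hμν).div_const 2) ?_
      exact ((hcurl _ μ ν α hc2).mul (hcurl _ μ ν β hc1)).continuousOn
  · exact (((continuous_apply α).comp hc1).mul ((continuous_apply β).comp hc2)).continuousOn

/-! ## §5 Entry bounds -/

/-- [folklore] `‖p̂_a(p)‖ ≤ 2‖p_a‖` when `‖p_a‖ ≤ 1`. -/
theorem norm_d1C_le_two_mul {p : Fin (d + 1) → ℂ} {a : Fin (d + 1)} (h : ‖p a‖ ≤ 1) : ‖d1C p a‖ ≤ 2 * ‖p a‖ := by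
  rw [d1C_apply]
  have h1 : ‖p a * I‖ ≤ 1 := by rw [norm_mul, Complex.norm_I, mul_one]; exact h
  have := Complex.norm_exp_sub_one_le h1
  rw [norm_mul, Complex.norm_I, mul_one] at this
  exact this

/-- [folklore] `‖p̂_a(p)‖ ≤ e^{|Im p_a|} + 1` (any complex `p`). -/
theorem norm_d1C_le_exp (p : Fin (d + 1) → ℂ) (a : Fin (d + 1)) : ‖d1C p a‖ ≤ Real.exp |(p a).im| + 1 := by
  rw [d1C_apply]
  refine (norm_sub_le _ _).trans ?_
  rw [Complex.norm_exp, norm_one]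
  have e : (p a * I).re = -(p a).im := by simp
  rw [e]
  have h := Real.exp_le_exp.mpr (neg_le_abs (p a).im)
  linarith

/-- [folklore] `‖p̂_a(−p)‖ ≤ e^{|Im p_a|} + 1`. -/
theorem norm_d1C_neg_le_exp (p : Fin (d + 1) → ℂ) (a : Fin (d + 1)) : ‖d1C (-p) a‖ ≤ Real.exp |(p a).im| + 1 := by
  have h := norm_d1C_le_exp (-p) a
  simp only [Pi.neg_apply, Complex.neg_im, abs_neg] at h
  exact h

/-- [folklore] **ENTRY BOUND OF THE EXCESS MATRIX**: entry bounds `‖V μ ν‖ ≤ v` (`μ ≠ ν`), `‖p̂_μ(−p)‖ ≤ a`, `‖p̂_μ(p)‖ ≤ b` give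
`‖exC V p α β‖ ≤ 2D²·v·a·b`. -/
theorem norm_exC_le {V : Fin (d + 1) → Fin (d + 1) → ℂ} {p : Fin (d + 1) → ℂ} {v a b : ℝ} (hv : 0 ≤ v) (ha : 0 ≤ a) (hb : 0 ≤ b)
    (hV : ∀ μ ν, μ ≠ ν → ‖V μ ν‖ ≤ v) (hA : ∀ μ, ‖d1C (-p) μ‖ ≤ a) (hB : ∀ μ, ‖d1C p μ‖ ≤ b) (α β : Fin (d + 1)) :
    ‖exC V p α β‖ ≤ 2 * ((d : ℝ) + 1) ^ 2 * v * a * b := by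
  unfold exC
  have hterm : ∀ μ ν : Fin (d + 1),
      ‖(if μ = ν then (0 : ℂ) else V μ ν / 2 * (curlRow (d1C (-p)) μ ν α * curlRow (d1C p) μ ν β))‖ ≤ v / 2 * (2 * a) * (2 * b) := by
    intro μ ν
    split_ifs with h
    · rw [norm_zero]; positivity
    · rw [norm_mul, norm_mul, norm_div, Complex.norm_two]
      have h1 := (norm_curlRow_le (d1C (-p)) μ ν α).trans (add_le_add (hA μ) (hA ν))
      have h2 := (norm_curlRow_le (d1C p) μ ν β).trans (add_le_add (hB μ) (hB ν))
      have h3 : ‖V μ ν‖ / 2 ≤ v / 2 := by linarith [hV μ ν h]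
      calc ‖V μ ν‖ / 2 * (‖curlRow (d1C (-p)) μ ν α‖ * ‖curlRow (d1C p) μ ν β‖)
          ≤ v / 2 * ((2 * a) * (2 * b)) := by
            apply mul_le_mul h3 _ (by positivity) (by positivity)
            exact mul_le_mul (by linarith) (by linarith) (norm_nonneg _) (by positivity)
        _ = v / 2 * (2 * a) * (2 * b) := by ring
  calc ‖∑ μ, ∑ ν, (if μ = ν then (0 : ℂ) else V μ ν / 2 * (curlRow (d1C (-p)) μ ν α * curlRow (d1C p) μ ν β))‖
      ≤ ∑ μ, ∑ ν, ‖(if μ = ν then (0 : ℂ) else V μ ν / 2 * (curlRow (d1C (-p)) μ ν α * curlRow (d1C p) μ ν β))‖ :=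
        (norm_sum_le _ _).trans (Finset.sum_le_sum fun μ _ => norm_sum_le _ _)
    _ ≤ ∑ _μ : Fin (d + 1), ∑ _ν : Fin (d + 1), v / 2 * (2 * a) * (2 * b) :=
        Finset.sum_le_sum fun μ _ => Finset.sum_le_sum fun ν _ => hterm μ ν
    _ = 2 * ((d : ℝ) + 1) ^ 2 * v * a * b := by
        simp only [Finset.sum_const, Finset.card_univ, Fintype.card_fin, nsmul_eq_mul]
        push_cast
        ring

end Summit.QuantumFields.BalabanUV.Beta.FP.CoarseCovarianceStripFeynReg

end
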